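import Literature.NumberTheory.LFunctions.WeilTwoPrimeOddMarginHBase
import Literature.NumberTheory.LFunctions.WeilTwoPrimeOddMarginHDataP22
import Literature.NumberTheory.LFunctions.WeilBlockRowsP
import HarnessLib

/-!
# Two-prime odd-margin certificate H: the materialized block agrees with `P_r`, rows 90–99

`WeilCert.checkPmRow` (row `k` of the claim `Pm_{kl} = P_r(2k+1, 2l+1)`) for certificate H, by `decide +kernel`. Pure proof file; nothing is asserted.
-/

noncomputable section

namespace Literature.NumberTheory.LFunctions

set_option maxHeartbeats 0 in
/-- Row 90 of the materialized block is row 90 of `P_r` (certificate H). [folklore] -/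
theorem checkPmRow1_90_weilCert23H : weilCert23HBase.checkPmRow weilCert23HNu weilCert23HPm 1 90 = true := by
  decide +kernel

set_option maxHeartbeats 0 in
/-- Row 91 of the materialized block is row 91 of `P_r` (certificate H). [folklore] -/
theorem checkPmRow1_91_weilCert23H : weilCert23HBase.checkPmRow weilCert23HNu weilCert23HPm 1 91 = true := by
  decide +kernel

set_option maxHeartbeats 0 in
/-- Row 92 of the materialized block is row 92 of `P_r` (certificate H). [folklore] -/
theorem checkPmRow1_92_weilCert23H : weilCert23HBase.checkPmRow weilCert23HNu weilCert23HPm 1 92 = true := by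
  decide +kernel

set_option maxHeartbeats 0 in
/-- Row 93 of the materialized block is row 93 of `P_r` (certificate H). [folklore] -/
theorem checkPmRow1_93_weilCert23H : weilCert23HBase.checkPmRow weilCert23HNu weilCert23HPm 1 93 = true := by
  decide +kernel

set_option maxHeartbeats 0 in
/-- Row 94 of the materialized block is row 94 of `P_r` (certificate H). [folklore] -/
theorem checkPmRow1_94_weilCert23H : weilCert23HBase.checkPmRow weilCert23HNu weilCert23HPm 1 94 = true := by
  decide +kernel

set_option maxHeartbeats 0 in
/-- Row 95 of the materialized block is row 95 of `P_r` (certificate H). [folklore] -/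
theorem checkPmRow1_95_weilCert23H : weilCert23HBase.checkPmRow weilCert23HNu weilCert23HPm 1 95 = true := by
  decide +kernel

set_option maxHeartbeats 0 in
/-- Row 96 of the materialized block is row 96 of `P_r` (certificate H). [folklore] -/
theorem checkPmRow1_96_weilCert23H : weilCert23HBase.checkPmRow weilCert23HNu weilCert23HPm 1 96 = true := by
  decide +kernel

set_option maxHeartbeats 0 in
/-- Row 97 of the materialized block is row 97 of `P_r` (certificate H). [folklore] -/
theorem checkPmRow1_97_weilCert23H : weilCert23HBase.checkPmRow weilCert23HNu weilCert23HPm 1 97 = true := by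
  decide +kernel

set_option maxHeartbeats 0 in
/-- Row 98 of the materialized block is row 98 of `P_r` (certificate H). [folklore] -/
theorem checkPmRow1_98_weilCert23H : weilCert23HBase.checkPmRow weilCert23HNu weilCert23HPm 1 98 = true := by
  decide +kernel

set_option maxHeartbeats 0 in
/-- Row 99 of the materialized block is row 99 of `P_r` (certificate H). [folklore] -/
theorem checkPmRow1_99_weilCert23H : weilCert23HBase.checkPmRow weilCert23HNu weilCert23HPm 1 99 = true := by
  decide +kernel


end Literature.NumberTheory.LFunctions
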